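import Mathlib
import Literature.NumberTheory.Irrationality.Fischler2002.JnChiProofs
import HarnessLib

/-!
# Fischler 2002 §3: the hypergeometric transformation `φ` of the `n`-fold family `𝒥(p)` — PROVED for every `n ≥ 2`

Topic `Literature/NumberTheory/Irrationality/Fischler2002`; proofs-only companion of `RhinViolaGroupsGeneral.lean`, whose
NAMED FACT `Jn_phi` is DISCHARGED here as `Jn_phi_holds` (cell `pub-zeta5`, seat ct-1 g29, 2026-08-27), after `Jn_chi`
(`JnChiProofs.lean`, same seat). Source: S. Fischler, « Formes linéaires en polyzêtas et intégrales multiples », C. R. Acad.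
Sci. Paris Sér. I **335** (2002) 1–4 = arXiv:math/0202064 [Fischler2002Polyzetas], §3 p. 4: "Notons `φ` l'automorphisme de `𝓔`
qui stabilise toutes les coordonnées, sauf `a_{n−1}` et `c_n` qu'il échange, `b_{n−1}` qu'il remplace par `a_{n−1} + b_{n−1} − c_n`
et `b_n` qu'il remplace par `a_{n−1} + b_n − c_n`. On a alors `𝒥(p) = a_{n−1}! b_{n−1}!/(c_n! (a_{n−1}+b_{n−1}−c_n)!) · 𝒥(φ(p))`"
(journal version [Fischler2003RhinViola], §3 Prop. 12: Euler's transformation in the variable `x_{n−1}`, available when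
`c₂ = ⋯ = c_{n−1} = 0`).

HONEST FRAMING (cells pub-zeta5 / zeta5-irr): systematic search; no irrationality claim unless certified. An identity between
(possibly infinite) `n`-fold integrals of non-negative functions; not an irrationality statement; nothing about `ζ(5)`.

## The proof (Euler's exchange in the second-to-last variable; no convergence hypothesis is used)
With `c₂ = ⋯ = c_{n−1} = 0` the integrand of `𝒥(p)` is `∏_k x_k^{a_k}(1−x_k)^{b_k} / δ_n^{c_n+1}`, and
`δ_n = 1 − x_n(1 − x_{n−1}δ_{n−2}) = (1 − x_n)(1 − w x_{n−1})` with `w = −x_nδ_{n−2}/(1 − x_n) ≤ 0`. Isolating `x_{n−1}`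
(`MeasurableEquiv.piFinSuccAbove` at the second-to-last index; Tonelli in `ℝ≥0∞`), the `x_{n−1}`-integral is Euler's integral
`∫₀¹ t^{a}(1−t)^{b}(1−wt)^{−c−1} dt` with `(a, b, c) = (a_{n−1}, b_{n−1}, c_n)`, and Euler's exchange
(`JnChi.euler_exchange`, the `A ↔ B` symmetry of `₂F₁`; here for every real `w < 1`) turns it into
`a!b!/(c!(a+b−c)!) ∫₀¹ t^{c}(1−t)^{a+b−c}(1−wt)^{−a−1} dt`, the `x_{n−1}`-integral of `𝒥(φ(p))` once the powers of `1 − x_n` are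
rebalanced (`b_n ↦ a_{n−1} + b_n − c_n`). Of the typed hypotheses only `c₂ = ⋯ = c_{n−1} = 0` and
`a_{n−1}, b_{n−1}, a_n, c_n, a_{n−1}+b_{n−1}−c_n ≥ 0` are used; the identity holds in `ℝ≥0∞`, finite or not. Theorems only, no
definition, no new named fact (net debt −1).
-/

noncomputable section

namespace Literature.NumberTheory.Irrationality.Fischler2002

open MeasureTheory Set Finset intervalIntegral
open scoped ENNReal Nat

namespace JnPhi

open JnChi

/-! ### Euler's exchange for every real `w < 1` (lower Lebesgue integrals) -/

/-- For `w < 1` and `0 ≤ t ≤ 1`, `1 − wt > 0`. [cite: Fischler2003RhinViola, §3 Proposition 12 (Euler's integral)] -/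
theorem euler_den_pos' {w t : ℝ} (hw : w < 1) (ht0 : 0 ≤ t) (ht1 : t ≤ 1) : 0 < 1 - w * t := by
  have : 1 - w * t = (1 - t) + t * (1 - w) := by ring
  rw [this]
  rcases eq_or_lt_of_le ht0 with h | h
  · rw [← h]; norm_num
  · nlinarith [mul_pos h (sub_pos.2 hw)]

/-- **Euler's exchange for lower Lebesgue integrals over `(0,1)`**, any real `w < 1`: for `a, b, c ∈ ℕ`, `c ≤ a+b`,
`∫⁻ ofReal(t^a(1−t)^b/(1−wt)^{c+1}) = ofReal(a!b!/(c!(a+b−c)!)) · ∫⁻ ofReal(t^c(1−t)^{a+b−c}/(1−wt)^{a+1})`.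
[cite: Fischler2003RhinViola, §3 Proposition 12] -/
theorem lintegral_euler_exchange' (a b c : ℕ) (hc : c ≤ a + b) {w : ℝ} (hw : w < 1) :
    ∫⁻ t in Ioo (0 : ℝ) 1, ENNReal.ofReal (t ^ a * (1 - t) ^ b / (1 - w * t) ^ (c + 1)) =
      ENNReal.ofReal (((a ! : ℝ) * (b ! : ℝ)) / ((c ! : ℝ) * ((a + b - c) ! : ℝ))) *
        ∫⁻ t in Ioo (0 : ℝ) 1, ENNReal.ofReal (t ^ c * (1 - t) ^ (a + b - c) / (1 - w * t) ^ (a + 1)) := by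
  have hcont : ∀ (u v k : ℕ), ContinuousOn (fun t : ℝ => t ^ u * (1 - t) ^ v / (1 - w * t) ^ (k + 1))
      (Set.uIcc (0 : ℝ) 1) := by
    intro u v k
    refine ContinuousOn.div (by fun_prop) (by fun_prop) fun t ht => ?_
    rw [Set.uIcc_of_le zero_le_one, Set.mem_Icc] at ht
    exact (pow_pos (euler_den_pos' hw ht.1 ht.2) _).ne'
  have hnn : ∀ (u v k : ℕ), ∀ t ∈ Ioo (0 : ℝ) 1, 0 ≤ t ^ u * (1 - t) ^ v / (1 - w * t) ^ (k + 1) := by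
    intro u v k t ht
    have h1 : 0 ≤ 1 - t := by linarith [ht.2]
    exact div_nonneg (mul_nonneg (pow_nonneg ht.1.le _) (pow_nonneg h1 _))
      (pow_nonneg (euler_den_pos' hw ht.1.le ht.2.le).le _)
  have hI : ∀ (u v k : ℕ), ∫⁻ t in Ioo (0 : ℝ) 1, ENNReal.ofReal (t ^ u * (1 - t) ^ v / (1 - w * t) ^ (k + 1)) =
      ENNReal.ofReal (∫ t in (0 : ℝ)..1, t ^ u * (1 - t) ^ v / (1 - w * t) ^ (k + 1)) := by
    intro u v k
    rw [intervalIntegral.integral_of_le zero_le_one, integral_Ioc_eq_integral_Ioo,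
      ofReal_integral_eq_lintegral_ofReal]
    · exact (intervalIntegrable_iff_integrableOn_Ioo_of_le zero_le_one).1 (hcont u v k).intervalIntegrable
    · exact (ae_restrict_iff' measurableSet_Ioo).2 (Filter.Eventually.of_forall (hnn u v k))
  rw [hI, hI, ← ENNReal.ofReal_mul (by positivity)]
  congr 1
  have hE := euler_exchange a b c hc hw
  have hcd : ((c ! : ℝ) * ((a + b - c) ! : ℝ)) ≠ 0 := by positivity
  rw [div_mul_eq_mul_div, eq_div_iff hcd]
  linear_combination hE

/-! ### Tonelli with an arbitrary coordinate innermost -/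

/-- **Tonelli with the `i`-th coordinate innermost**: for measurable `F ≥ 0` on `ℝ^{m+1}`,
`∫⁻_{(0,1)^{m+1}} F = ∫⁻_{y ∈ (0,1)^m} ∫⁻_{t ∈ (0,1)} F(insertNth i t y)`. [cite: Fischler2003RhinViola, §3 Proposition 12 (intégration en x_{n−1})] -/
theorem lintegral_openCube_insertNth {m : ℕ} (i : Fin (m + 1)) (F : (Fin (m + 1) → ℝ) → ℝ≥0∞) (hF : Measurable F) :
    ∫⁻ x in (Set.pi Set.univ fun _ : Fin (m + 1) => Ioo (0 : ℝ) 1), F x =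
      ∫⁻ y in (Set.pi Set.univ fun _ : Fin m => Ioo (0 : ℝ) 1), ∫⁻ t in Ioo (0 : ℝ) 1, F (Fin.insertNth i t y) := by
  have h1 : (volume : Measure (Fin (m + 1) → ℝ)).restrict (Set.pi Set.univ fun _ => Ioo (0 : ℝ) 1) =
      Measure.pi (fun _ : Fin (m + 1) => (volume : Measure ℝ).restrict (Ioo (0 : ℝ) 1)) := by
    rw [volume_pi, Measure.restrict_pi_pi]
  have h2 : (volume : Measure (Fin m → ℝ)).restrict (Set.pi Set.univ fun _ => Ioo (0 : ℝ) 1) =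
      Measure.pi (fun _ : Fin m => (volume : Measure ℝ).restrict (Ioo (0 : ℝ) 1)) := by
    rw [volume_pi, Measure.restrict_pi_pi]
  rw [h1, h2]
  set e := MeasurableEquiv.piFinSuccAbove (fun _ : Fin (m + 1) => ℝ) i with he
  have hmp := measurePreserving_piFinSuccAbove (fun _ : Fin (m + 1) => (volume : Measure ℝ).restrict (Ioo (0 : ℝ) 1)) i
  rw [← hmp.symm.lintegral_comp_emb e.symm.measurableEmbedding F,
    lintegral_prod_symm (fun z => F (e.symm z)) ((hF.comp e.symm.measurable).aemeasurable)]
  refine lintegral_congr fun y => lintegral_congr fun t => ?_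
  have hsymm : e.symm (t, y) = Fin.insertNth i t y := by
    rw [he, MeasurableEquiv.piFinSuccAbove_symm_apply]
    simp [Fin.insertNthEquiv]
  rw [hsymm]

/-! ### Coordinates of `insertNth` at the second-to-last index (`n = m+2`, `x_{n−1}` at position `m`) -/

/-- For `1 ≤ k ≤ m`, the `k`-th coordinate of `x = insertNth ⟨m⟩ t y` is that of `y`. [cite: Fischler2002Polyzetas, §3 p. 4] -/
theorem coord_ins_of_le {m : ℕ} (y : Fin (m + 1) → ℝ) (t : ℝ) {k : ℕ} (hk1 : 1 ≤ k) (hk : k ≤ m) :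
    coord (Fin.insertNth (⟨m, by omega⟩ : Fin (m + 2)) t y : Fin (m + 2) → ℝ) k = coord y k := by
  unfold coord
  rw [dif_pos ⟨hk1, by omega⟩, dif_pos ⟨hk1, by omega⟩]
  have hidx : (⟨k - 1, by omega⟩ : Fin (m + 2)) =
      (⟨m, by omega⟩ : Fin (m + 2)).succAbove (⟨k - 1, by omega⟩ : Fin (m + 1)) := by
    rw [Fin.succAbove_of_castSucc_lt _ _ (by rw [Fin.lt_def]; simp; omega)]
    rfl
  rw [hidx, Fin.insertNth_apply_succAbove]

/-- The coordinate `x_{m+1}` of `insertNth ⟨m⟩ t y` is `t`. [cite: Fischler2002Polyzetas, §3 p. 4] -/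
theorem coord_ins_mid {m : ℕ} (y : Fin (m + 1) → ℝ) (t : ℝ) :
    coord (Fin.insertNth (⟨m, by omega⟩ : Fin (m + 2)) t y : Fin (m + 2) → ℝ) (m + 1) = t := by
  unfold coord
  rw [dif_pos ⟨by omega, by omega⟩]
  have hidx : (⟨m + 1 - 1, by omega⟩ : Fin (m + 2)) = (⟨m, by omega⟩ : Fin (m + 2)) := by
    ext; simp
  rw [hidx, Fin.insertNth_apply_same]

/-- The last coordinate `x_{m+2}` of `insertNth ⟨m⟩ t y` is the last coordinate `y_{m+1}` of `y`.
[cite: Fischler2002Polyzetas, §3 p. 4] -/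
theorem coord_ins_last {m : ℕ} (y : Fin (m + 1) → ℝ) (t : ℝ) :
    coord (Fin.insertNth (⟨m, by omega⟩ : Fin (m + 2)) t y : Fin (m + 2) → ℝ) (m + 2) = coord y (m + 1) := by
  unfold coord
  rw [dif_pos ⟨by omega, le_rfl⟩, dif_pos ⟨by omega, le_rfl⟩]
  have hidx : (⟨m + 2 - 1, by omega⟩ : Fin (m + 2)) =
      (⟨m, by omega⟩ : Fin (m + 2)).succAbove (⟨m + 1 - 1, by omega⟩ : Fin (m + 1)) := by
    rw [Fin.succAbove_of_le_castSucc _ _ (by rw [Fin.le_def]; simp)]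
    ext; simp
  rw [hidx, Fin.insertNth_apply_succAbove]

/-- For `k ≤ m`, `δ_k(insertNth ⟨m⟩ t y) = δ_k(y)`. [cite: Fischler2002Polyzetas, §1 p. 2 (definition of δ_k)] -/
theorem deltaV_ins_of_le {m : ℕ} (y : Fin (m + 1) → ℝ) (t : ℝ) : ∀ {k : ℕ}, k ≤ m →
    deltaV (Fin.insertNth (⟨m, by omega⟩ : Fin (m + 2)) t y : Fin (m + 2) → ℝ) k = deltaV y k
  | 0, _ => by simp [deltaV]
  | k + 1, hk => by
      rw [deltaV, deltaV, coord_ins_of_le y t (by omega) hk, deltaV_ins_of_le y t (by omega)]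

/-- `δ_{m+2}(insertNth ⟨m⟩ t y) = 1 − y_{m+1}(1 − t·δ_m(y))`. [cite: Fischler2002Polyzetas, §1 p. 2 (definition of δ_k)] -/
theorem deltaV_ins_last {m : ℕ} (y : Fin (m + 1) → ℝ) (t : ℝ) :
    deltaV (Fin.insertNth (⟨m, by omega⟩ : Fin (m + 2)) t y : Fin (m + 2) → ℝ) (m + 2) =
      1 - coord y (m + 1) * (1 - t * deltaV y m) := by
  rw [deltaV, coord_ins_last, deltaV, coord_ins_mid, deltaV_ins_of_le y t le_rfl]

/-! ### The integrand on a fibre of the second-to-last coordinate -/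

/-- **Fibre form of the integrand** when `c₂ = ⋯ = c_{m+1} = 0` (`n = m+2`): with `u = y_{m+1}`, `δ = δ_m(y)`,
`integrand(p)(insertNth ⟨m⟩ t y) = G(y)·u^{a_n}(1−u)^{b_n}·t^{a_{n−1}}(1−t)^{b_{n−1}} / (D^{c_n}·D)`, `D = 1 − u(1 − tδ)`,
`G(y) = ∏_{k≤m} y_k^{a_k}(1−y_k)^{b_k}`. [cite: Fischler2002Polyzetas, §3 p. 4 (formule pour φ)] -/
theorem integrandJ_ins {m : ℕ} (p : Exponents) (hc0 : ∀ k, 2 ≤ k → k ≤ m + 1 → p.c k = 0)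
    (y : Fin (m + 1) → ℝ) (t : ℝ) :
    integrandJ (m + 2) p (Fin.insertNth (⟨m, by omega⟩ : Fin (m + 2)) t y) =
      (∏ k ∈ Icc 1 m, coord y k ^ p.a k * (1 - coord y k) ^ p.b k) *
        (coord y (m + 1) ^ p.a (m + 2) * (1 - coord y (m + 1)) ^ p.b (m + 2)) *
        (t ^ p.a (m + 1) * (1 - t) ^ p.b (m + 1)) /
        ((1 - coord y (m + 1) * (1 - t * deltaV y m)) ^ p.c (m + 2) * (1 - coord y (m + 1) * (1 - t * deltaV y m))) := by
  unfold integrandJ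
  rw [Finset.prod_Icc_succ_top (by omega : 1 ≤ m + 1 + 1), Finset.prod_Icc_succ_top (by omega : 1 ≤ m + 1),
    Finset.prod_Icc_succ_top (by omega : 2 ≤ m + 1 + 1), coord_ins_last, coord_ins_mid, deltaV_ins_last]
  have hP : ∏ k ∈ Icc 1 m, coord (Fin.insertNth (⟨m, by omega⟩ : Fin (m + 2)) t y : Fin (m + 2) → ℝ) k ^ p.a k *
        (1 - coord (Fin.insertNth (⟨m, by omega⟩ : Fin (m + 2)) t y : Fin (m + 2) → ℝ) k) ^ p.b k =
      ∏ k ∈ Icc 1 m, coord y k ^ p.a k * (1 - coord y k) ^ p.b k :=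
    Finset.prod_congr rfl fun k hk => by
      rw [coord_ins_of_le y t (Finset.mem_Icc.1 hk).1 (Finset.mem_Icc.1 hk).2]
  have hD : ∏ k ∈ Icc 2 (m + 1), deltaV (Fin.insertNth (⟨m, by omega⟩ : Fin (m + 2)) t y : Fin (m + 2) → ℝ) k ^ p.c k
      = 1 :=
    Finset.prod_eq_one fun k hk => by
      rw [hc0 k (Finset.mem_Icc.1 hk).1 (Finset.mem_Icc.1 hk).2, zpow_zero]
  rw [hP, hD, one_mul, div_div, show m + 1 + 1 = m + 2 from rfl]
  ring

/-- `φ(p)` has the same `c₂ = ⋯ = c_{n−1} = 0`. [cite: Fischler2002Polyzetas, §3 p. 4 (définition de φ)] -/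
theorem phi_c_zero {m : ℕ} (p : Exponents) (hc0 : ∀ k, 2 ≤ k → k ≤ m + 1 → p.c k = 0) :
    ∀ k, 2 ≤ k → k ≤ m + 1 → (phi (m + 2) p).c k = 0 := by
  intro k hk2 hk
  have hk' : k ≠ m + 2 := by omega
  simp [phi, hk', hc0 k hk2 hk]

end JnPhi

open JnChi JnPhi in
/-- **Fischler's hypergeometric transformation `φ` holds** (the named fact `Jn_phi` of `RhinViolaGroupsGeneral.lean` is a
theorem): for every `n ≥ 2` and `p` with `c₂ = ⋯ = c_{n−1} = 0` as typed,
`𝒥(p) = a_{n−1}! b_{n−1}!/(c_n! (a_{n−1}+b_{n−1}−c_n)!) · 𝒥(φ(p))` — Euler's exchange in the variable `x_{n−1}` (the identity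
holds in `ℝ≥0∞`, finite or not). [cite: Fischler2002Polyzetas, §3 p. 4 (formule pour φ)] [cite: Fischler2003RhinViola, §3 Proposition 12] -/
theorem Jn_phi_holds : Jn_phi := by
  intro n p hn hc0 hcrit hc habc
  obtain ⟨m, rfl⟩ : ∃ m, n = m + 2 := ⟨n - 2, by omega⟩
  obtain ⟨ha_all, hb_all, -⟩ := hcrit
  have hc0' : ∀ k, 2 ≤ k → k ≤ m + 1 → p.c k = 0 := fun k h2 hk => hc0 k h2 (by omega)
  simp only [show m + 2 - 1 = m + 1 by omega] at habc ⊢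
  have ha : 0 ≤ p.a (m + 1) := ha_all (m + 1) (Finset.mem_Icc.2 ⟨by omega, by omega⟩)
  have hb : 0 ≤ p.b (m + 1) := hb_all (m + 1) (Finset.mem_Icc.2 ⟨by omega, by omega⟩)
  have han : 0 ≤ p.a (m + 2) := ha_all (m + 2) (Finset.mem_Icc.2 ⟨by omega, le_rfl⟩)
  obtain ⟨A, hA⟩ := Int.eq_ofNat_of_zero_le ha
  obtain ⟨B, hB⟩ := Int.eq_ofNat_of_zero_le hb
  obtain ⟨C, hC⟩ := Int.eq_ofNat_of_zero_le hc
  have hCle : C ≤ A + B := by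
    have : (C : ℤ) ≤ A + B := by rw [← hA, ← hB, ← hC]; linarith
    exact_mod_cast this
  -- the factorial ratio
  have hratio : ENNReal.ofReal (((p.a (m + 1)).toNat.factorial * (p.b (m + 1)).toNat.factorial : ℕ) /
        ((p.c (m + 2)).toNat.factorial * (p.a (m + 1) + p.b (m + 1) - p.c (m + 2)).toNat.factorial : ℕ)) =
      ENNReal.ofReal (((A ! : ℝ) * (B ! : ℝ)) / ((C ! : ℝ) * ((A + B - C) ! : ℝ))) := by
    have hT : (p.a (m + 1) + p.b (m + 1) - p.c (m + 2)).toNat = A + B - C := by rw [hA, hB, hC]; omega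
    rw [hT, hA, hB, hC]
    simp only [Int.toNat_natCast]
    push_cast
    ring_nf
  rw [hratio]
  -- pass to the open cube and split off the coordinate `x_{n−1}`
  unfold Jn
  rw [← setLIntegral_congr (openCube_ae_eq_unitCube (m + 2)),
    ← setLIntegral_congr (openCube_ae_eq_unitCube (m + 2)),
    lintegral_openCube_insertNth (⟨m, by omega⟩ : Fin (m + 2)) _ (measurable_integrandJ _ _).ennreal_ofReal,
    lintegral_openCube_insertNth (⟨m, by omega⟩ : Fin (m + 2)) _ (measurable_integrandJ _ _).ennreal_ofReal,
    ← lintegral_const_mul' _ _ ENNReal.ofReal_ne_top]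
  refine setLIntegral_congr_fun (measurableSet_openCube (m + 1)) fun y hy => ?_
  -- on the fibre over `y ∈ (0,1)^{m+1}`
  have hy' : ∀ i, 0 < y i ∧ y i < 1 := fun i => by
    have := hy i (Set.mem_univ i); exact this
  obtain ⟨hd0, hd1, -⟩ := deltaV_mem hy' m (by omega)
  have hu : 0 < coord y (m + 1) ∧ coord y (m + 1) < 1 := by
    unfold coord; rw [dif_pos ⟨by omega, le_rfl⟩]; exact hy' _
  set u := coord y (m + 1) with hudef
  set δ := deltaV y m with hδdef
  have hv : (1 - u) ≠ 0 := by linarith [hu.2]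
  have hvpos : 0 < 1 - u := by linarith [hu.2]
  -- the Euler parameter `w = −uδ/(1−u) ≤ 0 < 1` and the factorisation of `δ_n`
  set w := -(u * δ) / (1 - u) with hwdef
  have hw : w < 1 := by
    have : w ≤ 0 := div_nonpos_of_nonpos_of_nonneg (by nlinarith [mul_pos hu.1 hd0]) hvpos.le
    linarith
  have hDen : ∀ t : ℝ, 1 - u * (1 - t * δ) = (1 - u) * (1 - w * t) := by
    intro t; rw [hwdef]; field_simp; ring
  set G := (∏ k ∈ Icc 1 m, coord y k ^ p.a k * (1 - coord y k) ^ p.b k) with hGdef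
  have hG : 0 ≤ G := by
    rw [hGdef]
    refine Finset.prod_nonneg fun k hk => ?_
    have hck : 0 < coord y k ∧ coord y k < 1 := by
      unfold coord; rw [dif_pos ⟨(Finset.mem_Icc.1 hk).1, by have := (Finset.mem_Icc.1 hk).2; omega⟩]; exact hy' _
    exact mul_nonneg (zpow_pos hck.1 _).le (zpow_pos (by linarith [hck.2]) _).le
  -- the common prefactor `K = G u^{a_n} (1−u)^{b_n} / (1−u)^{c_n+1}`
  set K := G * (u ^ p.a (m + 2) * (1 - u) ^ p.b (m + 2)) / (1 - u) ^ (C + 1) with hKdef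
  have hK : 0 ≤ K := by
    rw [hKdef]
    exact div_nonneg (mul_nonneg hG (mul_nonneg (zpow_pos hu.1 _).le (zpow_pos hvpos _).le)) (pow_pos hvpos _).le
  simp only [integrandJ_ins (phi (m + 2) p) (phi_c_zero p hc0'), integrandJ_ins p hc0']
  rw [← hGdef, ← hudef, ← hδdef]
  -- the exponents of `φ(p)` at `n−1`, `n`
  have e1 : (phi (m + 2) p).a (m + 1) = p.c (m + 2) := by simp [phi]
  have e2 : (phi (m + 2) p).b (m + 1) = p.a (m + 1) + p.b (m + 1) - p.c (m + 2) := by simp [phi]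
  have e3 : (phi (m + 2) p).a (m + 2) = p.a (m + 2) := by simp [phi]
  have e4 : (phi (m + 2) p).b (m + 2) = p.a (m + 1) + p.b (m + 2) - p.c (m + 2) := by simp [phi]
  have e5 : (phi (m + 2) p).c (m + 2) = p.a (m + 1) := by simp [phi]
  have eP : ∏ k ∈ Icc 1 m, coord y k ^ (phi (m + 2) p).a k * (1 - coord y k) ^ (phi (m + 2) p).b k = G :=
    Finset.prod_congr rfl fun k hk => by
      have h1 : k ≠ m + 1 := by have := (Finset.mem_Icc.1 hk).2; omega
      have h2 : k ≠ m + 2 := by have := (Finset.mem_Icc.1 hk).2; omega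
      simp [phi, h1, h2]
  rw [eP, e1, e2, e3, e4, e5]
  -- rewrite both fibre integrands as `K · (Euler integrand)`
  have hexpL : ∀ t : ℝ, G * (u ^ p.a (m + 2) * (1 - u) ^ p.b (m + 2)) * (t ^ p.a (m + 1) * (1 - t) ^ p.b (m + 1)) /
        ((1 - u * (1 - t * δ)) ^ p.c (m + 2) * (1 - u * (1 - t * δ))) =
      K * (t ^ A * (1 - t) ^ B / (1 - w * t) ^ (C + 1)) := by
    intro t
    rw [hA, hB, hC, zpow_natCast, zpow_natCast, zpow_natCast, hDen t, ← pow_succ, mul_pow, hKdef]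
    have h1 : (1 - u) ^ (C + 1) ≠ 0 := pow_ne_zero _ hv
    field_simp
  have hexpR : ∀ t : ℝ, G * (u ^ p.a (m + 2) * (1 - u) ^ (p.a (m + 1) + p.b (m + 2) - p.c (m + 2))) *
        (t ^ p.c (m + 2) * (1 - t) ^ (p.a (m + 1) + p.b (m + 1) - p.c (m + 2))) /
        ((1 - u * (1 - t * δ)) ^ p.a (m + 1) * (1 - u * (1 - t * δ))) =
      K * (t ^ C * (1 - t) ^ (A + B - C) / (1 - w * t) ^ (A + 1)) := by
    intro t
    have hT : p.a (m + 1) + p.b (m + 1) - p.c (m + 2) = ((A + B - C : ℕ) : ℤ) := by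
      rw [hA, hB, hC, Nat.cast_sub hCle]; push_cast; ring
    rw [hT, hA, hC, zpow_natCast, zpow_natCast, zpow_natCast, hDen t, ← pow_succ, mul_pow, hKdef]
    -- the powers of `1 − u` rebalance: `(1−u)^{A + b_n − C}/(1−u)^{A+1} = (1−u)^{b_n}/(1−u)^{C+1}`
    have hreb : (1 - u) ^ ((A : ℤ) + p.b (m + 2) - C) / (1 - u) ^ (A + 1) = (1 - u) ^ p.b (m + 2) / (1 - u) ^ (C + 1) := by
      rw [div_eq_div_iff (pow_ne_zero _ hv) (pow_ne_zero _ hv), ← zpow_natCast (1 - u) (C + 1),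
        ← zpow_natCast (1 - u) (A + 1), ← zpow_add₀ hv, ← zpow_add₀ hv]
      congr 1
      push_cast
      ring
    calc G * (u ^ p.a (m + 2) * (1 - u) ^ ((A : ℤ) + p.b (m + 2) - C)) * (t ^ C * (1 - t) ^ (A + B - C)) /
            ((1 - u) ^ (A + 1) * (1 - w * t) ^ (A + 1))
          = G * u ^ p.a (m + 2) * ((1 - u) ^ ((A : ℤ) + p.b (m + 2) - C) / (1 - u) ^ (A + 1)) *
              (t ^ C * (1 - t) ^ (A + B - C) / (1 - w * t) ^ (A + 1)) := by
            rw [mul_div_assoc, mul_div_mul_comm]; ring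
      _ = G * u ^ p.a (m + 2) * ((1 - u) ^ p.b (m + 2) / (1 - u) ^ (C + 1)) *
              (t ^ C * (1 - t) ^ (A + B - C) / (1 - w * t) ^ (A + 1)) := by rw [hreb]
      _ = G * (u ^ p.a (m + 2) * (1 - u) ^ p.b (m + 2)) / (1 - u) ^ (C + 1) *
              (t ^ C * (1 - t) ^ (A + B - C) / (1 - w * t) ^ (A + 1)) := by
            rw [mul_div_assoc, mul_div_assoc]; ring
  simp only [hexpL, hexpR]
  -- pull `K` out and apply Euler's exchange in `t`
  simp only [ENNReal.ofReal_mul hK]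
  rw [lintegral_const_mul' _ _ ENNReal.ofReal_ne_top, lintegral_const_mul' _ _ ENNReal.ofReal_ne_top,
    lintegral_euler_exchange' A B C hCle hw]
  ring

end Literature.NumberTheory.Irrationality.Fischler2002

end
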